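import Mathlib.NumberTheory.Padics.Hensel
import Mathlib.NumberTheory.Padics.RingHoms
import HarnessLib

/-!
# `n`-th roots of `1`-units in `ℤ_p` for `p ∤ n` (Hensel); every `2`-adic unit is a cube

`Literature/NumberTheory/LocalFields/PadicOneUnitRoots.lean`. Hensel's lemma (Gouvêa, *p-adic
Numbers*, Thm. 4.5.2: `F ∈ ℤ_p[X]`, `F(α₁) ≡ 0 (mod p)`, `F'(α₁) ≢ 0 (mod p)` ⇒ a root `α ≡ α₁`)
applied to `F = Xⁿ − α` at `α₁ = 1`: **a `1`-unit `α ≡ 1 (mod p)` of `ℤ_p` is an `n`-th power for every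
`n` prime to `p`** — equivalently, by Serre's structure theorem `U₁ ≅ ℤ_p` (`p ≠ 2`),
`U₁ = {±1} × U₂`, `U₂ ≅ ℤ₂` (*A Course in Arithmetic*, Ch. II §3.2, Prop. 8 / Thm. 2), raising to an
`n`-th power with `p ∤ n` is bijective on `U₁`. In particular **every unit of `ℤ₂` is a cube**
(`ℤ₂^× = U₁`, `2 ∤ 3`), the Hensel step "`∛αⱼ ∈ ℤ₂`" of a `2`-adic `q = 3` Kummer descent (abc
cell, route `PadicPrimesYuNinety`, crux `YuNinetyTwo`). Not here: roots of non-principal units for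
`p ≠ 2` (reduce to Teichmüller × `U₁`).

## References
* [Gouvea1993PadicNumbers] F. Q. Gouvêa, *p-adic Numbers*, Springer 1993 — Thm. 4.5.2 (Hensel's
  Lemma), §4.6 (applications: roots of unity, squares).
* [Serre1973] J.-P. Serre, *A Course in Arithmetic*, GTM 7 — Ch. II §3.2, Prop. 8, Thm. 2.
-/

noncomputable section

open Polynomial

namespace Literature.NumberTheory.LocalFields

variable {p : ℕ} [Fact p.Prime]

/-- **`1`-units are `n`-th powers for `p ∤ n`** (Hensel's lemma for `Xⁿ − α` at `1`:
`‖1 − α‖ < 1 = ‖n‖²`): if `α ∈ ℤ_p` with `‖α − 1‖ < 1` and `p ∤ n`, there is `y ∈ ℤ_p` with `yⁿ = α`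
and `‖y − 1‖ < 1`. (Serre: `U₁ ≅ ℤ_p` for `p ≠ 2`, `U₂ ≅ ℤ₂`, on which `n` acts invertibly.)
[cite: Gouvea1993PadicNumbers, Thm. 4.5.2 (Hensel's Lemma), applied to Xⁿ − α]
[cite: Serre1973, Ch. II §3.2 Prop. 8 / Thm. 2 (consequence)] -/
theorem padicInt_exists_pow_eq_of_norm_sub_one_lt {n : ℕ} (hn : ¬ p ∣ n) {α : ℤ_[p]}
    (hα : ‖α - 1‖ < 1) : ∃ y : ℤ_[p], y ^ n = α ∧ ‖y - 1‖ < 1 := by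
  set F : Polynomial ℤ_[p] := X ^ n - C α with hF
  have hF1 : F.aeval (1 : ℤ_[p]) = 1 - α := by simp [hF]
  have hF'1 : F.derivative.aeval (1 : ℤ_[p]) = (n : ℤ_[p]) := by
    rw [hF]
    simp only [derivative_sub, derivative_X_pow, derivative_C, sub_zero, map_mul, map_pow,
      aeval_X, map_natCast, one_pow, mul_one]
  have hnu : ‖(n : ℤ_[p])‖ = 1 :=
    PadicInt.norm_natCast_eq_one_iff.mpr ((Nat.Prime.coprime_iff_not_dvd Fact.out).mpr hn)
  have hnorm : ‖F.aeval (1 : ℤ_[p])‖ < ‖F.derivative.aeval (1 : ℤ_[p])‖ ^ 2 := by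
    rw [hF1, hF'1, hnu, one_pow, ← norm_neg, neg_sub]; exact hα
  obtain ⟨y, hy, hy1, -⟩ := hensels_lemma hnorm
  refine ⟨y, ?_, ?_⟩
  · have : y ^ n - α = 0 := by simpa [hF] using hy
    exact sub_eq_zero.mp this
  · rw [hF'1, hnu] at hy1; exact hy1

/-- **Every `2`-adic unit is a cube** (`ℤ₂^× = 1 + 2ℤ₂` and `2 ∤ 3`): for `α ∈ ℤ₂` with `‖α‖ = 1`
there is `y ∈ ℤ₂` with `y³ = α` — the Hensel step "`∛αⱼ ∈ ℤ₂`" of the `2`-adic cubic Kummer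
descent. [cite: Serre1973, Ch. II §3.2 Prop. 8 / Thm. 2 (consequence: U₁ = {±1} × U₂, U₂ ≅ ℤ₂)]
[cite: Gouvea1993PadicNumbers, Thm. 4.5.2 (Hensel's Lemma)] -/
theorem padicInt_two_exists_cube_eq {α : ℤ_[2]} (hα : ‖α‖ = 1) : ∃ y : ℤ_[2], y ^ 3 = α := by
  haveI : Fact (Nat.Prime 2) := ⟨Nat.prime_two⟩
  -- a `2`-adic unit is `≡ 1 (mod 2)`
  have h1 : ‖α - 1‖ < 1 := by
    rw [← PadicInt.mem_nonunits, ← IsLocalRing.mem_maximalIdeal, ← PadicInt.ker_toZMod,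
      RingHom.mem_ker, map_sub, map_one, sub_eq_zero]
    have hu : IsUnit (PadicInt.toZMod α) := (PadicInt.isUnit_iff.mpr hα).map _
    -- the only unit of `ZMod 2` is `1`
    obtain ⟨u, hu'⟩ := hu
    rw [← hu']
    have hne : (u : ZMod 2) ≠ 0 := u.ne_zero
    generalize (u : ZMod 2) = w at hne ⊢
    fin_cases w
    · exact absurd rfl hne
    · rfl
  obtain ⟨y, hy, -⟩ := padicInt_exists_pow_eq_of_norm_sub_one_lt (p := 2) (n := 3) (by norm_num) h1
  exact ⟨y, hy⟩

end Literature.NumberTheory.LocalFields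

end
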